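import Summits.CriticalPhenomena.PercolationContinuityZ3.Theorems.PercNearOneGluingNoHeavyQuantLongTailTripleHubRoute
import Summits.CriticalPhenomena.PercolationContinuityZ3.Theorems.PercNearOneGluingNoHeavyQuantShapeHubNarrow
import Summits.CriticalPhenomena.PercolationContinuityZ3.Theorems.PercNearOneGluingNoHeavyQuantShapeSibling
import HarnessLib

/-!
# QUANT lane R8, T-DEC: THE LONG-TAIL TRIPLE HUB — the width-3 sub-floor hub `S(γ₁) ∗ S(γ₂) ∗ S(γ₃)` of EVERY shape `{lo, lo+K; γ}` with `2lo < K ≤ 3lo` is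
# SDEC at EVERY gate `γᵢ ≥ lo/K` and every affordable floor, by ONE UNSPLIT route per outer gate (census-1 gen 32; companion of `sdec_sHub_two_long`)

builds on p205010 (kernel theorem, internal audit signed; external expert review pending)

Support file (`--supports stmt-CriticalPhenomena-4575`), QUANT lane seat prim-quant-census-1 (gen 32); memo
`run/shared/lean/prim/quant/prim-quant-census-1/g32/TWOLO-G32.md` §6.  Theorems only, standard axioms, no sorries.  Uses arm-1 g50's torque-cost
criterion `decAt_all_of_torqueCost` / g49's `decAt_all_of_lowCeiling`, g31's `lconv_sp_apply` / `sHub_laws` / `sHub_struct`, the closed forms of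
`…QuantLongTailTripleHubAlg` and the route `tripleHubLong_route` (`…QuantLongTailTripleHubRoute`).

THE LAW.  `sHub lo K [γ₁, γ₂, γ₃]` lives on `{3lo, 3lo+K, 3lo+2K, 3lo+3K}` with the Poisson-binomial masses `u₀..u₃` of the three gates, mean
`T₀ = 3lo + K(γ₁+γ₂+γ₃)`; the `|S| = 3` term of the piece expansion of a forest of glued siblings `R^lo[qᵢ](R^K[gᵢ])`.  For `2lo < K ≤ 3lo` the width-3
hub has a single positive low `3lo` (`T > 6lo`); g32's near-route theorem `sdec_sHub_three` needed `K ≤ 2lo` for its capacity discharge (mean-gate binomial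
extremality), and for `K > 2lo` the farthest-near route can FAIL capacity with true masses (e.g. `lo/K = 0.35`, gates `2/3`, `T → 3lo+2K`), so a cost route
is needed: the low goes to `3lo+K` (near) while its credit capacity `(T−6lo)(u₀+u₁) ≤ K·u₁` lasts, then to `3lo+2K`, which is still FAR when
`T < 3lo+2K` (torque cost, certified like the pair hub's top route); the top atom is never used.
* **`sdec_sHub_three_long`** — `2lo < K ≤ 3lo`; `P = [γ₁, γ₂, γ₃]` with `lo ≤ Kγᵢ`, `γᵢ < 1`, `x(lo+K) ≤ lo+Kγᵢ`; `0 < x` ⟹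
  **`SDEC x ((lo+K)·3) (sHub lo K P)`**; **`sdec_sHub_three_all`** — with g32's `sdec_sHub_three` (`K ≤ 2lo`): every `lo < K ≤ 3lo`.
NUMERICS (memo §5–§6, code/exp30/exp32/exp33, exact rationals): the rule certifies every (hub, gate) instance on 8 shapes `2.25 ≤ K/lo ≤ 3` (2 690–3 697
instances each, 0 failures; the top atom needed 0 times; the middle-low floor capacity never binds); unsplit assignments exist up to `K = 4.5lo` (two lows
appear beyond `3lo`).

HONEST STATUS.  A core lemma (width 3); with `sdec_sHub_two_all` the hubs of widths 2 and 3 of every shape `lo < K ≤ 3lo` are SDEC at every gate; the piece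
beside a blob for `K > 2lo` (2–3-way split routes) and the widths `≥ 4` with gates below `1/2` remain the blockers of long-tail forest theorems;
`SiblingStep`, `GluedDominatedMass`, `SDECConvClosed`, `FarTreeRow` OPEN; RATE class (log\*) / honest sentence of `run/shared/lean/prim/quant/README.md`
unchanged.  [this work].  Nothing here is cited as a published result.  The gluing rows served [cite: KozmaNitzan2024, Conjecture 3 (p. 15)]; product
measure [cite: Grimmett1999, §1.3 p. 10].
-/

noncomputable section

open scoped BigOperators

namespace Summit.CriticalPhenomena.PercolationContinuityZ3.Theorems
namespace Quant
namespace LawDec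

open Finset

/-- the FAR-GIANT PIECE of shape `(lo, K)`: `S(γ) = {lo: 1−γ, lo+K: γ}` -/
local notation3 "SP[" lo ", " K ", " a "]" => (fun h : ℕ => (1 - (a : ℝ)) * (if h = (lo : ℕ) then (1 : ℝ) else 0) +
  (a : ℝ) * (if h = (lo : ℕ) + (K : ℕ) then (1 : ℝ) else 0))

/-! ### The long-tail triple hub is SDEC -/

/-- **THE LONG-TAIL TRIPLE HUB IS SDEC.**  For `2lo < K ≤ 3lo`, three gates `P = [γ₁, γ₂, γ₃]` with `lo ≤ Kγᵢ`, `γᵢ < 1`, `x(lo+K) ≤ lo + Kγᵢ`, and every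
floor `0 < x`: `SDEC x ((lo+K)·|P|) (sHub lo K P)`. [this work] -/
theorem sdec_sHub_three_long (lo K : ℕ) (hK2 : 2 * lo < K) (hK3 : K ≤ 3 * lo) {x : ℝ} (hx0 : 0 < x) (P : List ℝ)
    (hP3 : P.length = 3) (hP : ∀ γ ∈ P, (lo : ℝ) ≤ K * γ ∧ γ < 1 ∧ x * ((lo : ℝ) + K) ≤ lo + K * γ) :
    SDEC x ((lo + K) * P.length) (sHub lo K P) := by
  obtain ⟨γ₁, γ₂, γ₃, rfl⟩ := List.length_eq_three.1 hP3
  obtain ⟨hγ₁, hγ₁1, hx₁⟩ := hP γ₁ (by simp)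
  obtain ⟨hγ₂, hγ₂1, hx₂⟩ := hP γ₂ (by simp)
  obtain ⟨hγ₃, hγ₃1, hx₃⟩ := hP γ₃ (by simp)
  have hloK : lo < K := by omega
  have hlo1 : 1 ≤ lo := by omega
  have hloR : (1 : ℝ) ≤ lo := by exact_mod_cast hlo1
  have hKR : (lo : ℝ) < K := by exact_mod_cast hloK
  have hK2R' : 2 * lo ≤ K := by omega
  have hK0 : (0 : ℝ) < K := by linarith
  have hγ₁0 : 0 ≤ γ₁ := by
    by_contra hc; push Not at hc; have := mul_neg_of_pos_of_neg hK0 hc; linarith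
  have hγ₂0 : 0 ≤ γ₂ := by
    by_contra hc; push Not at hc; have := mul_neg_of_pos_of_neg hK0 hc; linarith
  have hγ₃0 : 0 ≤ γ₃ := by
    by_contra hc; push Not at hc; have := mul_neg_of_pos_of_neg hK0 hc; linarith
  have hx1 : x < 1 := by
    have : (lo : ℝ) + K * γ₁ < lo + K := by have := mul_lt_mul_of_pos_left hγ₁1 hK0; linarith
    by_contra hc; push Not at hc
    have : 1 * ((lo : ℝ) + K) ≤ x * (lo + K) := mul_le_mul_of_nonneg_right hc (by linarith)
    linarith
  -- the inner pair hub `L₂ = sHub lo K [γ₂, γ₃]`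
  have hP01₂ : ∀ γ ∈ [γ₂, γ₃], 0 ≤ γ ∧ γ ≤ 1 := by
    intro γ hγ; simp only [List.mem_cons, List.mem_nil_iff, or_false] at hγ
    rcases hγ with rfl | rfl
    · exact ⟨hγ₂0, hγ₂1.le⟩
    · exact ⟨hγ₃0, hγ₃1.le⟩
  obtain ⟨m0, mM, _, _⟩ := sHub_laws lo K [γ₂, γ₃] hP01₂
  have elen₂ : (lo + K) * ([γ₂, γ₃] : List ℝ).length = (lo + K) * 2 := rfl
  set L₂ : ℕ → ℝ := sHub lo K [γ₂, γ₃] with hL₂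
  have cM : ∀ i, (lo + K) * 1 < i → SP[lo, K, γ₃] i = 0 := fun i hi => (sp_laws lo K hγ₃0 hγ₃1.le).2.1 i (by omega)
  have hS3 : sHub lo K [γ₃] = SP[lo, K, γ₃] := funext fun k => lconv_delta_left _ (lo + K) _ (sp_laws lo K hγ₃0 hγ₃1.le).2.1 k
  have hdef₂ : L₂ = lconv ((lo + K) * 1) (lo + K) SP[lo, K, γ₃] SP[lo, K, γ₂] := by
    rw [hL₂]; show lconv _ _ (sHub lo K [γ₃]) _ = _; rw [hS3]; rfl
  have Lv₂ : ∀ k, L₂ k = (1 - γ₂) * (if lo ≤ k then SP[lo, K, γ₃] (k - lo) else 0) + γ₂ * (if lo + K ≤ k then SP[lo, K, γ₃] (k - (lo + K)) else 0) :=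
    fun k => by rw [hdef₂]; exact lconv_sp_apply lo K ((lo + K) * 1) SP[lo, K, γ₃] γ₂ cM k
  have wlo : L₂ (2 * lo) = (1 - γ₂) * (1 - γ₃) := by
    rw [Lv₂, if_pos (by omega), if_neg (by omega), show 2 * lo - lo = lo by omega]
    dsimp only; rw [if_pos rfl, if_neg (by omega)]; ring
  have wmid : L₂ (2 * lo + K) = γ₂ * (1 - γ₃) + γ₃ * (1 - γ₂) := by
    rw [Lv₂, if_pos (by omega), if_pos (by omega), show 2 * lo + K - lo = lo + K by omega, show 2 * lo + K - (lo + K) = lo by omega]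
    dsimp only; rw [if_neg (by omega), if_pos rfl, if_pos rfl, if_neg (by omega)]; ring
  have wtop : L₂ (2 * lo + 2 * K) = γ₂ * γ₃ := by
    rw [Lv₂, if_pos (by omega), if_pos (by omega), show 2 * lo + 2 * K - lo = lo + 2 * K by omega,
      show 2 * lo + 2 * K - (lo + K) = lo + K by omega]
    dsimp only; rw [if_neg (by omega), if_neg (by omega), if_neg (by omega), if_pos rfl]; ring
  have mM₂ : ∀ i, (lo + K) * 2 < i → L₂ i = 0 := fun i hi => mM i (by rw [elen₂]; exact hi)
  -- the triple hub `L = L₂ ∗ S(γ₁)`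
  have hP01 : ∀ γ ∈ [γ₁, γ₂, γ₃], 0 ≤ γ ∧ γ ≤ 1 := by
    intro γ hγ; simp only [List.mem_cons, List.mem_nil_iff, or_false] at hγ
    rcases hγ with rfl | rfl | rfl
    · exact ⟨hγ₁0, hγ₁1.le⟩
    · exact ⟨hγ₂0, hγ₂1.le⟩
    · exact ⟨hγ₃0, hγ₃1.le⟩
  obtain ⟨l0, lM, l1, lmean⟩ := sHub_laws lo K [γ₁, γ₂, γ₃] hP01
  have eT0 : (([γ₁, γ₂, γ₃] : List ℝ).map (fun γ => (lo : ℝ) + K * γ)).sum = 3 * (lo : ℝ) + K * (γ₁ + γ₂ + γ₃) := by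
    simp only [List.map_cons, List.map_nil, List.sum_cons, List.sum_nil]; ring
  rw [eT0] at lmean
  have elen : (lo + K) * ([γ₁, γ₂, γ₃] : List ℝ).length = 3 * lo + 3 * K := by show (lo + K) * 3 = 3 * lo + 3 * K; ring
  rw [elen] at lM l1 lmean ⊢
  set L : ℕ → ℝ := sHub lo K [γ₁, γ₂, γ₃] with hL
  have hdef : L = lconv ((lo + K) * 2) (lo + K) L₂ SP[lo, K, γ₁] := by rw [hL, hL₂]; rfl
  have Lv : ∀ k, L k = (1 - γ₁) * (if lo ≤ k then L₂ (k - lo) else 0) + γ₁ * (if lo + K ≤ k then L₂ (k - (lo + K)) else 0) :=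
    fun k => by rw [hdef]; exact lconv_sp_apply lo K ((lo + K) * 2) L₂ γ₁ mM₂ k
  have vlo : L (3 * lo) = (1 - γ₁) * ((1 - γ₂) * (1 - γ₃)) := by
    rw [Lv, if_pos (by omega), if_neg (by omega), show 3 * lo - lo = 2 * lo by omega, wlo]; ring
  have vmid : L (3 * lo + K) = (1 - γ₁) * (γ₂ * (1 - γ₃) + γ₃ * (1 - γ₂)) + γ₁ * ((1 - γ₂) * (1 - γ₃)) := by
    rw [Lv, if_pos (by omega), if_pos (by omega), show 3 * lo + K - lo = 2 * lo + K by omega, show 3 * lo + K - (lo + K) = 2 * lo by omega,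
      wmid, wlo]
  have vtop : L (3 * lo + 2 * K) = (1 - γ₁) * (γ₂ * γ₃) + γ₁ * (γ₂ * (1 - γ₃) + γ₃ * (1 - γ₂)) := by
    rw [Lv, if_pos (by omega), if_pos (by omega), show 3 * lo + 2 * K - lo = 2 * lo + 2 * K by omega,
      show 3 * lo + 2 * K - (lo + K) = 2 * lo + K by omega, wtop, wmid]
  -- support: charged atoms are `3lo + Ks`
  have hsupp : ∀ k, L k ≠ 0 → ∃ s, k = lo * 3 + K * s ∧ s ≤ 3 := by
    intro k hk
    have := (sHub_struct lo K hloK 0 le_rfl [γ₁, γ₂, γ₃] (fun γ hγ => ⟨(hP01 γ hγ).1, (hP01 γ hγ).2, by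
      rw [zero_mul]; exact (hP01 γ hγ).1⟩)).1 k hk
    simpa using this
  clear_value L₂ L
  intro a ha0 ha1 j' hj'
  obtain ⟨g0, gM, g1⟩ := gate_laws (3 * lo + 3 * K) L a ha0.le ha1 l0 lM l1
  have gmean : ∑ h ∈ Finset.range (3 * lo + 3 * K + 1), (h : ℝ) * gate L a h = a * (3 * (lo : ℝ) + K * (γ₁ + γ₂ + γ₃)) := by
    rw [sum_mul_gate, lmean]
  have gv : ∀ h, h ≠ 0 → gate L a h = a * L h := fun h hh => by rw [gate_apply, if_neg hh, mul_zero, add_zero]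
  set T : ℝ := a * (3 * (lo : ℝ) + K * (γ₁ + γ₂ + γ₃)) with hT
  have hax0 : 0 < a * x := mul_pos ha0 hx0
  have hax1 : a * x < 1 := by have := mul_le_mul_of_nonneg_right ha1 hx0.le; linarith
  have hT0p : 0 < 3 * (lo : ℝ) + K * (γ₁ + γ₂ + γ₃) := by
    have := mul_nonneg hK0.le (add_nonneg (add_nonneg hγ₁0 hγ₂0) hγ₃0); linarith
  have hT0 : 0 < T := mul_pos ha0 hT0p
  have hTle : T ≤ 3 * (lo : ℝ) + K * (γ₁ + γ₂ + γ₃) := by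
    have := mul_le_mul_of_nonneg_right ha1 hT0p.le; rw [hT]; linarith
  have hta : a * x * ((3 * lo + 3 * K : ℕ) : ℝ) ≤ T := by
    have h2 : x * (3 * (lo : ℝ) + 3 * K) ≤ 3 * (lo : ℝ) + K * (γ₁ + γ₂ + γ₃) := by linarith
    have h3 := mul_le_mul_of_nonneg_left h2 ha0.le
    push_cast; rw [hT]; linarith
  -- a charged low is the bottom atom `3lo`
  have lowatom : ∀ l : ℕ, 1 ≤ l → 2 * (l : ℝ) < T → 0 < gate L a l → l = 3 * lo := by
    intro l hl hlT hpos
    have hLl : L l ≠ 0 := by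
      intro h0; rw [gv l (by omega), h0, mul_zero] at hpos; exact lt_irrefl _ hpos
    obtain ⟨s, hs, _⟩ := hsupp l hLl
    rcases Nat.eq_zero_or_pos s with h0 | hs1
    · rw [hs, h0]; ring
    · exfalso
      have h1 : (K : ℝ) * 1 ≤ K * s := mul_le_mul_of_nonneg_left (by exact_mod_cast hs1) hK0.le
      have hl' : (l : ℝ) = lo * 3 + K * s := by rw [hs]; push_cast; ring
      have : (K : ℝ) * (γ₁ + γ₂ + γ₃) < K * 3 := mul_lt_mul_of_pos_left (by linarith) hK0
      have hK3R : (K : ℝ) ≤ 3 * lo := by exact_mod_cast hK3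
      linarith
  by_cases hT6 : 6 * (lo : ℝ) < T
  · -- one positive low: the route
    have v0 : gate L a (3 * lo) = a * ((1 - γ₁) * ((1 - γ₂) * (1 - γ₃))) := by rw [gv _ (by omega), vlo]
    have v1 : gate L a (3 * lo + K) = a * ((1 - γ₁) * (γ₂ * (1 - γ₃) + γ₃ * (1 - γ₂)) + γ₁ * ((1 - γ₂) * (1 - γ₃))) := by
      rw [gv _ (by omega), vmid]
    have v2 : gate L a (3 * lo + 2 * K) = a * ((1 - γ₁) * (γ₂ * γ₃) + γ₁ * (γ₂ * (1 - γ₃) + γ₃ * (1 - γ₂))) := by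
      rw [gv _ (by omega), vtop]
    -- the least gate first
    obtain ⟨t, ht, hTt, hcapt, hcostt⟩ : ∃ t : ℕ, (t = 3 * lo + K ∨ t = 3 * lo + 2 * K) ∧ (T < ((3 * lo : ℕ) : ℝ) + (t : ℝ)) ∧
        freeRate (a * x) T (3 * lo) t * gate L a (3 * lo) ≤ gate L a t ∧
        (if T < (t : ℝ) then ((t : ℝ) - T) * (freeRate (a * x) T (3 * lo) t * gate L a (3 * lo)) else 0)
          ≤ ∑ l ∈ Finset.range (3 * lo + 3 * K + 1), (if (1 ≤ l ∧ (l : ℝ) < T) then gate L a l * (T - l) else 0) := by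
      by_cases h12 : γ₁ ≤ γ₂
      · by_cases h13 : γ₁ ≤ γ₃
        · exact tripleHubLong_route lo K hloK hK2R' hK3 (gate L a) (a * x) T a γ₁ γ₂ γ₃ x g0 h12 h13 hγ₁ hγ₂1 hγ₃1 hx0 hx₁ ha0 ha1 rfl
            (by rw [hT]) hT6 (by rw [v0]; ring) (by rw [v1]; ring) (by rw [v2]; ring)
        · push Not at h13
          exact tripleHubLong_route lo K hloK hK2R' hK3 (gate L a) (a * x) T a γ₃ γ₁ γ₂ x g0 h13.le (le_trans h13.le h12) hγ₃ hγ₁1 hγ₂1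
            hx0 hx₃ ha0 ha1 rfl (by rw [hT]; ring) hT6 (by rw [v0]; ring) (by rw [v1]; ring) (by rw [v2]; ring)
      · push Not at h12
        by_cases h23 : γ₂ ≤ γ₃
        · exact tripleHubLong_route lo K hloK hK2R' hK3 (gate L a) (a * x) T a γ₂ γ₁ γ₃ x g0 h12.le h23 hγ₂ hγ₁1 hγ₃1 hx0 hx₂ ha0 ha1 rfl
            (by rw [hT]; ring) hT6 (by rw [v0]; ring) (by rw [v1]; ring) (by rw [v2]; ring)
        · push Not at h23
          exact tripleHubLong_route lo K hloK hK2R' hK3 (gate L a) (a * x) T a γ₃ γ₁ γ₂ x g0 (le_trans h23.le h12.le) h23.le hγ₃ hγ₁1 hγ₂1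
            hx0 hx₃ ha0 ha1 rfl (by rw [hT]; ring) hT6 (by rw [v0]; ring) (by rw [v1]; ring) (by rw [v2]; ring)
    have httop : t ≤ 3 * lo + 3 * K := by rcases ht with rfl | rfl <;> omega
    have htmem : t ∈ Finset.range (3 * lo + 3 * K + 1) := Finset.mem_range.2 (by omega)
    have htlo : 3 * lo < t := by rcases ht with rfl | rfl <;> omega
    have rowlo : ∑ h ∈ Finset.range (3 * lo + 3 * K + 1), (if 3 * lo = 3 * lo ∧ h = t then gate L a (3 * lo) else 0)
        = gate L a (3 * lo) := by
      rw [Finset.sum_eq_single_of_mem t htmem (fun h _ hh => by simp [hh])]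
      simp
    have rowz : ∀ l : ℕ, l ≠ 3 * lo →
        ∑ h ∈ Finset.range (3 * lo + 3 * K + 1), (if l = 3 * lo ∧ h = t then gate L a (3 * lo) else 0) = 0 := by
      intro l hl; exact Finset.sum_eq_zero fun h _ => by simp [hl]
    have colt : ∑ l ∈ Finset.range (3 * lo + 3 * K + 1), freeRate (a * x) T l t * (if l = 3 * lo ∧ t = t then gate L a (3 * lo) else 0)
        = freeRate (a * x) T (3 * lo) t * gate L a (3 * lo) := by
      rw [Finset.sum_eq_single_of_mem (3 * lo) (Finset.mem_range.2 (by omega)) (fun l _ hl => by simp [hl])]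
      simp
    have colz : ∀ h : ℕ, h ≠ t →
        ∑ l ∈ Finset.range (3 * lo + 3 * K + 1), freeRate (a * x) T l h * (if l = 3 * lo ∧ h = t then gate L a (3 * lo) else 0) = 0 := by
      intro h hh; exact Finset.sum_eq_zero fun l _ => by simp [hh]
    have c3lo : ((3 * lo : ℕ) : ℝ) = 3 * (lo : ℝ) := by push_cast; ring
    refine decAt_all_of_torqueCost (a * x) (3 * lo + 3 * K) (gate L a) T
      (fun l h => if l = 3 * lo ∧ h = t then gate L a (3 * lo) else 0) hax0 hax1 g0 gM g1 gmean hT0 hta ?_ ?_ ?_ ?_ ?_ j' hj'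
    · intro l h; split_ifs
      · exact g0 _
      · exact le_rfl
    · intro l h hlh
      split_ifs at hlh with hc
      · obtain ⟨rfl, rfl⟩ := hc
        exact ⟨by omega, by rw [c3lo]; linarith, htlo, httop, hTt⟩
      · exact absurd hlh (lt_irrefl _)
    · intro l hl hlow
      by_cases hl' : l = 3 * lo
      · subst hl'; exact rowlo
      · rw [rowz l hl']
        rcases (g0 l).eq_or_lt with h0 | hpos
        · exact h0
        · exact absurd (lowatom l hl hlow hpos) hl'
    · intro h _
      by_cases hh : h = t
      · subst hh; rw [colt]; exact hcapt
      · rw [colz h hh]; exact g0 h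
    · rw [Finset.sum_eq_single_of_mem t htmem (fun h _ hh => by rw [colz h hh, mul_zero, ite_self])]
      rw [colt]
      exact hcostt
  · -- no positive low atom
    refine decAt_all_of_lowCeiling (a * x) (3 * lo + 3 * K) (gate L a) T hax0 hax1 g0 gM g1 gmean hT0 hta ?_ j' hj'
    intro l hl hlow hpos
    exfalso
    have h2 := lowatom l hl hlow hpos
    subst h2
    push_cast at hlow
    exact hT6 (by linarith)

/-- **THE WIDTH-3 HUB OF EVERY SHAPE `lo < K ≤ 3lo` IS SDEC** at every gate `γᵢ ≥ lo/K` and every affordable floor (`sdec_sHub_three` for `K ≤ 2lo`,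
`sdec_sHub_three_long` for `2lo < K ≤ 3lo`). [this work] -/
theorem sdec_sHub_three_all (lo K : ℕ) (hloK : lo < K) (hK3 : K ≤ 3 * lo) {x : ℝ} (hx0 : 0 < x) (P : List ℝ) (hP3 : P.length = 3)
    (hP : ∀ γ ∈ P, (lo : ℝ) ≤ K * γ ∧ γ < 1 ∧ x * ((lo : ℝ) + K) ≤ lo + K * γ) :
    SDEC x ((lo + K) * P.length) (sHub lo K P) := by
  rcases le_or_gt K (2 * lo) with h | h
  · exact sdec_sHub_three lo K hloK h hx0 P hP3 hP
  · exact sdec_sHub_three_long lo K h hK3 hx0 P hP3 hP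

end LawDec
end Quant
end Summit.CriticalPhenomena.PercolationContinuityZ3.Theorems
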